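import Mathlib
import HarnessLib
import Summits.HubbardSuperconductivity.HubbardSuperconductivity.Theorems.WeakCouplingBCSKlCertTPrimeSoundnessWindow

/-!
# Route `WeakCouplingBCS` — certificate vocabulary for `WcbcsKohnLuttingerB1g` (stmt-HubbardSuperconductivity-0158):
# the JOINT-ENCLOSURE currency of a `t′` Kohn–Luttinger certificate record, WINDOW level («(ε) in (δ)'s clothes»)

Cell `gate-hubbard-kl`, successor docket «W3′-RECORD-SHAPE» line (ε′) (pen (R424)(B), rank 1); vehicle = planner hubbard-klscan-idea-3 g16/g17
(`Sketch16.lean` / `r17/Sketch17.lean` §1–§2, farm-checked, refuter hubbard-klscan-crit-1 x-read PASS), filed by margin-1 (g18) VERBATIM up to this docstring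
and the file split (§3, the arithmetic SPEC of `dJ`, is the sibling `Theorems/WeakCouplingBCSKlCertTPrimeJointDual.lean`).  ADDITIVE: no existing declaration
is touched; no `instance`, no `notation`; the record types `KLTrig` / `KLBlock` / `KLBox` / `KLCert` and the `t′` vocabulary of
`Theorems/WeakCouplingBCSDefsKlCertTPrime.lean` / `…KlCertTPrimeSoundnessWindow.lean` (`KLTPAnalytic`, `RitzEnclosureTP`, `kltp_window`) are REUSED.

WHY A NEW HYPOTHESIS KIND.  The separate-enclosure currency of `checkB1gD` + `EnclosuresB1gTP` (margin-1's accepted (δ) record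
`Theorems/WeakCouplingBCSDefsKlCertB1gTPm03D0125Record.lean`, `γ = 33811/2²⁰`) charges the `B1g` Ritz ceiling (E2: `q ≤ Qhi`) and each rival's far floor
(E4: `HS²_χ ≤ Hhi`) at their SEPARATE worst cases over the certified hull table of `χ₀`.  Both are functionals of the SAME kernel values; the JOINT enclosure
`JointEnclosureTP bB bχ tab tp μ χ dJ :↔ √(HS²_χ/dmult χ) + q_B1g/Nhi ≤ dJ` bounds their SUM at once (certified from the table by the orientation-split
entrywise Lagrange dual, sibling file §3), and `jointEnclosureTP_of_separate` shows it is never weaker than separate charging.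

§1 (block level, PROVED): actual-value quantities `hsSqMass`, `ritzN`, `ritzQ`; the hypothesis `JointEnclosureTP`; L1 `rayleighUpperTP_holds` (actual-value
Ritz ceiling) and L2 `hs_floor` (actual-value far floor with multiplicity, from `kltp_channelFar_mult`); the composition `joint_box_certificate'`.
§2 (record/window level, PROVED): the joint row type `KLJRow` (`dJ` of the four rivals of a box), the standalone JOINT checker `checkB1gJ c rows γ` (window
literals, cover, `B1g` Ritz usability, per rival `deflOK ∧ withU-test ∧ γ ≤ −dJ` — it does NOT require the separate-currency literals `farOKd`/`b1gLeadsOK`),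
the named hypothesis `JointEnclosuresB1gTP c rows tp` (per box and `μ`: E1–E2 of the `B1g` block + the four joint enclosures), the cover logic
`kltpj_coverLogic`, and the window theorems **`kltpj_window`** / **`kltpj_window_U`** concluding `KLB1gDominatesAtTP tp mub mua γ` / `KLB1gDominatesTP tp mub mua γ`
— literally the conclusion shapes of `kltp_window(_U)`.

Nothing here is a record and no number is asserted; nothing here asserts a margin at any `t′`, `K₃`, `U₀`, the window or superconductivity.  A Kohn–Luttinger
`O(U²)` channel statement is not ODLRO and nothing here proves superconductivity in the Hubbard model.  No `sorry`, no instances, no notation.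
References: M. Reed, B. Simon, *Methods of Modern Mathematical Physics* IV, Thm. XIII.1–XIII.2 (min–max), XIII.5 (Temple); S. Raghu, S. A. Kivelson,
D. J. Scalapino, Phys. Rev. B 81 (2010) 224505, §II–§III; S. M. Rump, Acta Numerica 19 (2010) 287–449, §10 (verified bounds for quadratic forms).
-/

noncomputable section

-- the tree's namespace `Summit.<Summit>.<Problem>.Theorems` repeats the summit name by design (D-0017)
set_option linter.dupNamespace false

namespace Summit.HubbardSuperconductivity.HubbardSuperconductivity.Theorems.KlCertTPrimeJoint

open MeasureTheory Literature.MathematicalPhysics.QuantumLattice Literature.Analysis.OperatorTheory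
open Summit.HubbardSuperconductivity.HubbardSuperconductivity.Theorems
open Summit.HubbardSuperconductivity.HubbardSuperconductivity.Theorems.CwKLChiralWindow
open Summit.HubbardSuperconductivity.HubbardSuperconductivity.Theorems.CwKLChiralWindow.Negative

/-! ## §1 Block level: actual-value quantities, the joint hypothesis, L1, L2, the joint box certificate -/

/-- E4's quantity, ACTUAL value: the deflated sector square mass `∫∫ (K_χ − Σ c u⊗u)² d(σ⊗σ)` of the block `b` in the
channel `χ` for `ε_{t′}` at `μ` (`σ = fermiCurveMeasure (squareDispersion 1 tp) μ`). [folklore] -/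
def hsSqMass (b : KLBlock) (tab : List KLTrig) (tp μ : ℝ) (χ : D4Irrep) : ℝ :=
  ∫ z, (b.sectorKernelTP tp μ χ z.1 z.2 - b.deflKernel tab z.1 z.2) ^ 2
    ∂(fermiCurveMeasure (squareDispersion 1 tp) μ).prod (fermiCurveMeasure (squareDispersion 1 tp) μ)

/-- E1's quantity, ACTUAL value: `N = ∫ Φ² dσ` of the block's trial. [folklore] -/
def ritzN (b : KLBlock) (tab : List KLTrig) (tp μ : ℝ) : ℝ :=
  ∫ k, b.trialFun tab k ^ 2 ∂fermiCurveMeasure (squareDispersion 1 tp) μ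

/-- E2's quantity, ACTUAL value: `q = ∫ Φ(k) (∫ κ_{t′}(k,k') Φ(k') dσ) dσ` of the block's trial. [folklore] -/
def ritzQ (b : KLBlock) (tab : List KLTrig) (tp μ : ℝ) : ℝ :=
  ∫ k, b.trialFun tab k *
    ∫ k', b.baseKernelTP tp μ k k' * b.trialFun tab k' ∂fermiCurveMeasure (squareDispersion 1 tp) μ
    ∂fermiCurveMeasure (squareDispersion 1 tp) μ

/-- The symmetry multiplicity as a real number (`2` on `E`, else `1`; cf. `KLBlock.dmult`). [folklore] -/
def dmultR (χ : D4Irrep) : ℝ := if χ = D4Irrep.E then 2 else 1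

/-- `dmult χ > 0`. [folklore] -/
theorem dmultR_pos (χ : D4Irrep) : 0 < dmultR χ := by
  unfold dmultR; split_ifs <;> norm_num

/-- **The JOINT enclosure hypothesis** (the new named numerical hypothesis kind): for the TRUE kernel at `(t′, μ)`, the far
defect of the rival block `bχ` and the Ritz numerator of the `B1g` block `bB` satisfy `√(HS²_χ/dmult χ) + q_B1g/Nhi ≤ dJ`.  It is
implied neither by E2 nor by E4 separately: it says the SAME kernel values cannot be worst-case for the `B1g` ceiling and for the
rival floor at once (certified from the table by the orientation-split entrywise Lagrange dual of §3; separate charging gives only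
`√(Hhi/dmult) + Qhi/Nhi`, `jointEnclosureTP_of_separate`). [folklore] -/
def JointEnclosureTP (bB bχ : KLBlock) (tab : List KLTrig) (tp μ : ℝ) (χ : D4Irrep) (dJ : ℚ) : Prop :=
  Real.sqrt (hsSqMass bχ tab tp μ χ / dmultR χ) + ritzQ bB tab tp μ / (bB.Nhi : ℝ) ≤ (dJ : ℝ)

/-- **L1, the ACTUAL-VALUE Ritz ceiling** as a named statement: for a block whose trial is in the harmonic pattern of `χ`,
in the equality case, `channelInf ε_{t′} μ 1 χ ≤ q/N` whenever `0 < N`. [folklore] -/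
def RayleighUpperTP (tp μ : ℝ) (b : KLBlock) (tab : List KLTrig) (χ : D4Irrep) : Prop :=
  0 < ritzN b tab tp μ → channelInf (squareDispersion 1 tp) μ 1 χ ≤ ritzQ b tab tp μ / ritzN b tab tp μ

/-- **L1 PROVED** — the direct Ritz argument of `kltp_ritz_upper` (normalised trial `ψ = Φ/√N`, `channelInf ≤ pairingForm ψ = q/N`)
with the block's number `rhohi` replaced by the actual value `q/N`.  Hypotheses: the checker's `ritzOK` (only its `fits` conjunct
is used) and the equality case `withU ∨ χ ≠ A1g`. [folklore] -/
theorem rayleighUpperTP_holds {tp μ : ℝ} (hμ : KLTPAnalytic (squareDispersion 1 tp) μ) (b : KLBlock)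
    (tab : List KLTrig) (χ : D4Irrep) (hR : b.ritzOK tab χ = true) (hcase : b.withU = true ∨ χ ≠ D4Irrep.A1g) :
    RayleighUpperTP tp μ b tab χ := by
  intro hN
  have hR' := hR
  simp only [KLBlock.ritzOK, Bool.and_eq_true, decide_eq_true_eq] at hR'
  obtain ⟨⟨⟨⟨⟨⟨⟨-, -⟩, hfits⟩, -⟩, -⟩, -⟩, -⟩, -⟩ := hR'
  set σ := fermiCurveMeasure (squareDispersion 1 tp) μ with hσ
  set Φ : Momentum → ℝ := b.trialFun tab with hΦ
  change 0 < ∫ k, Φ k ^ 2 ∂σ at hN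
  set N : ℝ := ∫ k, Φ k ^ 2 ∂σ with hNdef
  haveI hfin : IsFiniteMeasure σ := hμ.1
  have hinv := hμ.2.1
  have hΦmem : MemLp Φ 2 σ := kltp_tr_toFun_memLp (klTab tab b.trial) hμ
  have hΦch : InChannel χ Φ := stub_klTrigChannel (klTab tab b.trial) χ hfits
  set c : ℝ := (Real.sqrt N)⁻¹ with hc
  have hsqrt : 0 < Real.sqrt N := Real.sqrt_pos.2 hN
  have hc2N : c ^ 2 * N = 1 := by
    rw [hc, inv_pow, Real.sq_sqrt hN.le, inv_mul_cancel₀ hN.ne']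
  have hc2 : 0 < c ^ 2 := by positivity
  have hc2inv : c ^ 2 = N⁻¹ := by
    rw [hc, inv_pow, Real.sq_sqrt hN.le]
  set ψ : Momentum → ℝ := fun k => c * Φ k with hψ
  have hψmem : MemLp ψ 2 σ := hΦmem.const_mul c
  have hψch : InChannel χ ψ := by
    have h := kl_hc_inChannel_linear χ Φ Φ c 0 hΦch hΦch
    simpa using h
  have hψnorm : ∫ k, ψ k ^ 2 ∂σ = 1 := by
    simp only [hψ, mul_pow]
    rw [integral_const_mul]
    exact hc2N
  have hstate : IsChannelState (squareDispersion 1 tp) μ χ ψ := ⟨hψmem, hψnorm, hψch⟩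
  have hval : pairingForm (squareDispersion 1 tp) μ 1 ψ =
      c ^ 2 * ∫ k, Φ k * ∫ k', b.baseKernelTP tp μ k k' * Φ k' ∂σ ∂σ := by
    cases hw : b.withU with
    | true =>
      have hker : ∀ k k', b.baseKernelTP tp μ k k' = kohnLuttingerKernel (squareDispersion 1 tp) μ 1 k k' := by
        intro k k'
        rw [KLBlock.baseKernelTP, hw, kl_cb_kernel_one]
        simp
      simp_rw [hker]
      rw [← klb1g_form_smul]
      rfl
    | false =>
      have hχ : χ ≠ D4Irrep.A1g := by
        rcases hcase with h | h
        · rw [hw] at h; exact absurd h Bool.false_ne_true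
        · exact h
      have hmean : ∫ k, ψ k ∂σ = 0 := (stub_klMeanZero _ _ hfin hinv χ ψ hχ hstate).2
      obtain ⟨hsplit, -⟩ := kltp_frameHS _ μ hμ 1 ψ hψmem
      have hker : ∀ k k', b.baseKernelTP tp μ k k' = lindhardFunction (squareDispersion 1 tp) μ (k + k') := by
        intro k k'
        rw [KLBlock.baseKernelTP, hw]
        simp
      simp_rw [hker]
      rw [hsplit, hmean, ← klb1g_form_smul σ _ Φ c]
      norm_num
      rfl
  have hQ : c ^ 2 * ∫ k, Φ k * ∫ k', b.baseKernelTP tp μ k k' * Φ k' ∂σ ∂σ = ritzQ b tab tp μ / ritzN b tab tp μ := by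
    rw [hc2inv, div_eq_mul_inv, mul_comm]
    rfl
  unfold channelInf
  exact (csInf_le (kltp_bddBelow hμ χ) ⟨ψ, hstate, rfl⟩).trans (hval.trans hQ).le

/-- **L2, the ACTUAL-VALUE far floor with multiplicity** — `−√(HS²_χ/dmult χ) ≤ channelInf ε_{t′} μ 1 χ` for an admissible
deflation (`deflOK`, `withU` only on `A1g`): `kltp_channelFar_mult` with `h :=` the square mass itself and `s := √(h/dmult)`.
(Min–max: the deflation is a non-negative operator, so the lowest levels of `K_χ − Σ c u⊗u` lie below those of `K_χ`; on `E` the bottom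
of `K` is a doublet, hence TWO levels `≤ λ_min` and `2 λ_min² ≤ HS²`.) [cite: ReedSimonIV1978, Thm. XIII.1] -/
theorem hs_floor {tp μ : ℝ} (hμ : KLTPAnalytic (squareDispersion 1 tp) μ) (b : KLBlock) (tab : List KLTrig)
    (χ : D4Irrep) (hdefl : b.deflOK tab χ = true) (hwu : (!b.withU || decide (χ = D4Irrep.A1g)) = true) :
    -Real.sqrt (hsSqMass b tab tp μ χ / dmultR χ) ≤ channelInf (squareDispersion 1 tp) μ 1 χ := by
  have hh : 0 ≤ hsSqMass b tab tp μ χ := integral_nonneg fun z => sq_nonneg _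
  have hd : 0 < dmultR χ := dmultR_pos χ
  have hmul : (if χ = D4Irrep.E then (2 : ℝ) else 1) * Real.sqrt (hsSqMass b tab tp μ χ / dmultR χ) ^ 2 =
      hsSqMass b tab tp μ χ := by
    rw [Real.sq_sqrt (div_nonneg hh hd.le)]
    unfold dmultR
    split_ifs <;> field_simp
  refine kltp_channelFar_mult (squareDispersion 1 tp) μ hμ χ b.withU b.defl.length
    (fun m => ((b.defl[(m : ℕ)].1 : ℚ) : ℝ)) (fun m => (klTab tab b.defl[(m : ℕ)].2).toFun)
    (hsSqMass b tab tp μ χ) (Real.sqrt (hsSqMass b tab tp μ χ / dmultR χ)) (kl_bkb_withU hwu)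
    (kl_bkb_defl_nonneg hdefl) (fun m => kltp_tr_toFun_memLp _ hμ) ?_ (Real.sqrt_nonneg _) (le_of_eq hmul.symm)
  rw [kltp_bkb_sqmass_eq b tab tp μ χ]
  rfl

/-- **The JOINT box certificate (composition, PROVED)**: at a level `μ` where the analytic facts hold, given (i) the actual-value Ritz
ceiling for the `B1g` block (L1), (ii) the literals `0 < Nlo`, `Qhi < 0`, `γ ≤ −dJ`, (iii) the `B1g` Ritz enclosures E1–E2 (existing
hypothesis kind), (iv) an admissible rival deflation, and (v) the JOINT enclosure `dJ` (new hypothesis kind) —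
`channelInf ε_{t′} μ 1 B1g + γ ≤ channelInf ε_{t′} μ 1 χ`. [folklore] -/
theorem joint_box_certificate {tp μ : ℝ} (hμ : KLTPAnalytic (squareDispersion 1 tp) μ)
    (bB bχ : KLBlock) (tab : List KLTrig) (χ : D4Irrep) (γ dJ : ℚ)
    (hRay : RayleighUpperTP tp μ bB tab D4Irrep.B1g)
    (hNlo : 0 < bB.Nlo) (hQhi : bB.Qhi < 0) (hγ : γ ≤ -dJ)
    (hER : bB.RitzEnclosureTP tab tp μ)
    (hdefl : bχ.deflOK tab χ = true) (hwu : (!bχ.withU || decide (χ = D4Irrep.A1g)) = true)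
    (hJ : JointEnclosureTP bB bχ tab tp μ χ dJ) :
    channelInf (squareDispersion 1 tp) μ 1 D4Irrep.B1g + ((γ : ℚ) : ℝ) ≤ channelInf (squareDispersion 1 tp) μ 1 χ := by
  obtain ⟨h1, h2, h3, h4⟩ := hER
  change ((bB.Nlo : ℚ) : ℝ) ≤ ritzN bB tab tp μ at h1
  change ritzN bB tab tp μ ≤ ((bB.Nhi : ℚ) : ℝ) at h2
  change ritzQ bB tab tp μ ≤ ((bB.Qhi : ℚ) : ℝ) at h4
  have hNlo' : (0 : ℝ) < ((bB.Nlo : ℚ) : ℝ) := by exact_mod_cast hNlo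
  have hQhi' : ((bB.Qhi : ℚ) : ℝ) < 0 := by exact_mod_cast hQhi
  have hN : 0 < ritzN bB tab tp μ := lt_of_lt_of_le hNlo' h1
  have hNhi : 0 < ((bB.Nhi : ℚ) : ℝ) := lt_of_lt_of_le hN h2
  have hq : ritzQ bB tab tp μ ≤ 0 := (h4.trans hQhi'.le)
  have hceil : channelInf (squareDispersion 1 tp) μ 1 D4Irrep.B1g ≤ ritzQ bB tab tp μ / ritzN bB tab tp μ := hRay hN
  have hqN : ritzQ bB tab tp μ / ritzN bB tab tp μ ≤ ritzQ bB tab tp μ / ((bB.Nhi : ℚ) : ℝ) := by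
    have hle : 1 / ((bB.Nhi : ℚ) : ℝ) ≤ 1 / ritzN bB tab tp μ := one_div_le_one_div_of_le hN h2
    have h := mul_le_mul_of_nonpos_left hle hq
    calc ritzQ bB tab tp μ / ritzN bB tab tp μ
        = ritzQ bB tab tp μ * (1 / ritzN bB tab tp μ) := div_eq_mul_one_div _ _
      _ ≤ ritzQ bB tab tp μ * (1 / ((bB.Nhi : ℚ) : ℝ)) := h
      _ = ritzQ bB tab tp μ / ((bB.Nhi : ℚ) : ℝ) := (div_eq_mul_one_div _ _).symm
  have hfloor := hs_floor hμ bχ tab χ hdefl hwu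
  have hJ' : Real.sqrt (hsSqMass bχ tab tp μ χ / dmultR χ) + ritzQ bB tab tp μ / ((bB.Nhi : ℚ) : ℝ) ≤ ((dJ : ℚ) : ℝ) := hJ
  have hγ' : ((γ : ℚ) : ℝ) ≤ -((dJ : ℚ) : ℝ) := by exact_mod_cast hγ
  linarith

/-- **The JOINT box certificate, hypothesis-free in L1** (uses `rayleighUpperTP_holds`): the remaining named numerical hypotheses are
exactly E1–E2 of the `B1g` block (`RitzEnclosureTP`, existing kind) and the JOINT enclosure `dJ` (new kind); everything else is decided
by the checker (`ritzOK`, `deflOK`, the `withU` test, `γ ≤ −dJ`). [folklore] -/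
theorem joint_box_certificate' {tp μ : ℝ} (hμ : KLTPAnalytic (squareDispersion 1 tp) μ)
    (bB bχ : KLBlock) (tab : List KLTrig) (χ : D4Irrep) (γ dJ : ℚ)
    (hRB : bB.ritzOK tab D4Irrep.B1g = true) (hγ : γ ≤ -dJ)
    (hER : bB.RitzEnclosureTP tab tp μ)
    (hdefl : bχ.deflOK tab χ = true) (hwu : (!bχ.withU || decide (χ = D4Irrep.A1g)) = true)
    (hJ : JointEnclosureTP bB bχ tab tp μ χ dJ) :
    channelInf (squareDispersion 1 tp) μ 1 D4Irrep.B1g + ((γ : ℚ) : ℝ) ≤ channelInf (squareDispersion 1 tp) μ 1 χ := by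
  have hR' := hRB
  simp only [KLBlock.ritzOK, Bool.and_eq_true, decide_eq_true_eq] at hR'
  obtain ⟨⟨⟨⟨⟨⟨⟨-, -⟩, -⟩, hNlo⟩, -⟩, -⟩, hQhi⟩, -⟩ := hR'
  exact joint_box_certificate hμ bB bχ tab χ γ dJ
    (rayleighUpperTP_holds hμ bB tab D4Irrep.B1g hRB (Or.inr (by decide))) hNlo hQhi hγ hER hdefl hwu hJ

/-- Separate charging is the special case: if E4's `Hhi` and E2's `Qhi` hold separately then the joint hypothesis holds with any
`dJ ≥ √(Hhi/dmult) + Qhi/Nhi` — a joint record is never WEAKER than the (δ)-currency record built from the same blocks. [folklore] -/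
theorem jointEnclosureTP_of_separate (bB bχ : KLBlock) (tab : List KLTrig) (tp μ : ℝ) (χ : D4Irrep) (dJ : ℚ)
    (hNhi : 0 < bB.Nhi)
    (hH : hsSqMass bχ tab tp μ χ ≤ (bχ.Hhi : ℝ)) (hQ : ritzQ bB tab tp μ ≤ (bB.Qhi : ℝ))
    (hd : Real.sqrt ((bχ.Hhi : ℝ) / dmultR χ) + (bB.Qhi : ℝ) / (bB.Nhi : ℝ) ≤ (dJ : ℝ)) :
    JointEnclosureTP bB bχ tab tp μ χ dJ := by
  unfold JointEnclosureTP
  have hd0 : 0 < dmultR χ := dmultR_pos χ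
  have hNhi' : (0 : ℝ) < (bB.Nhi : ℝ) := by exact_mod_cast hNhi
  have h1 : Real.sqrt (hsSqMass bχ tab tp μ χ / dmultR χ) ≤ Real.sqrt ((bχ.Hhi : ℝ) / dmultR χ) :=
    Real.sqrt_le_sqrt (div_le_div_of_nonneg_right hH hd0.le)
  have h2 : ritzQ bB tab tp μ / (bB.Nhi : ℝ) ≤ (bB.Qhi : ℝ) / (bB.Nhi : ℝ) :=
    div_le_div_of_nonneg_right hQ hNhi'.le
  linarith

/-! ## §2 Record / window level: the joint row, the joint checker, the named hypothesis, the window theorems -/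

/-- **One joint row**: the certified rationals `dJ_χ` of the four rival channels of a box (the `B1g` block of the box is the
ceiling block in each). [folklore] -/
structure KLJRow where
  /-- `dJ` of the `A1g` rival -/
  dA1g : ℚ
  /-- `dJ` of the `A2g` rival -/
  dA2g : ℚ
  /-- `dJ` of the `B2g` rival -/
  dB2g : ℚ
  /-- `dJ` of the `E` rival -/
  dE : ℚ

/-- Reading a joint row by channel (`0` on `B1g`, which is not a rival). [folklore] -/
def KLJRow.get (r : KLJRow) : D4Irrep → ℚ
  | .A1g => r.dA1g
  | .A2g => r.dA2g
  | .B1g => 0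
  | .B2g => r.dB2g
  | .E => r.dE

/-- The joint literals of one rival block: admissible deflation, `withU` only on `A1g`, and `γ ≤ −dJ`. [folklore] -/
def jointBlockOK (b : KLBlock) (tab : List KLTrig) (χ : D4Irrep) (dJ γ : ℚ) : Bool :=
  b.deflOK tab χ && (!b.withU || decide (χ = D4Irrep.A1g)) && decide (γ ≤ -dJ)

/-- The joint literals of one box: usable `B1g` Ritz data and the joint literals of the four rivals. [folklore] -/
def jointBoxOK (bx : KLBox) (tab : List KLTrig) (row : KLJRow) (γ : ℚ) : Bool :=
  bx.bB1g.ritzOK tab D4Irrep.B1g &&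
    jointBlockOK bx.bA1g tab D4Irrep.A1g row.dA1g γ && jointBlockOK bx.bA2g tab D4Irrep.A2g row.dA2g γ &&
    jointBlockOK bx.bB2g tab D4Irrep.B2g row.dB2g γ && jointBlockOK bx.bE tab D4Irrep.E row.dE γ

/-- **The JOINT checker** (standalone: it does not require the separate-currency literals `farOKd` / `b1gLeadsOK` of `checkB1gD`):
`mub < mua`, `0 < γ`, boxes non-empty, contiguous and covering `[mub, mua]`, one joint row per box, and the joint literals of every
box.  The `μ`-range / van Hove exclusion is carried by `KLTPAnalytic` per box, as in `kltp_window`. [folklore] -/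
def checkB1gJ (c : KLCert) (rows : List KLJRow) (γ : ℚ) : Bool :=
  decide (c.mub < c.mua) && decide (0 < γ) &&
    (match c.boxes.head?, c.boxes.getLast? with
      | some b₀, some b₁ => decide (b₀.mulo ≤ c.mub) && decide (c.mua ≤ b₁.muhi)
      | _, _ => false) &&
    KLCert.chainOK c.boxes && decide (rows.length = c.boxes.length) &&
    ((c.boxes.zip rows).all fun p => jointBoxOK p.1 c.trials p.2 γ)

/-- **The named numerical hypothesis of a joint record at hopping `t′`**: on every box, uniformly in `μ`, the `t′` Ritz enclosures
E1–E2 of the `B1g` block (existing kind, `RitzEnclosureTP`) and the four JOINT enclosures `dJ_χ` of the row (new kind). [folklore] -/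
def JointEnclosuresB1gTP (c : KLCert) (rows : List KLJRow) (tp : ℝ) : Prop :=
  ∀ p ∈ c.boxes.zip rows, ∀ μ ∈ Set.Icc (p.1.mulo : ℝ) (p.1.muhi : ℝ),
    p.1.bB1g.RitzEnclosureTP c.trials tp μ ∧
      ∀ χ : D4Irrep, χ ≠ D4Irrep.B1g → JointEnclosureTP p.1.bB1g (p.1.blk χ) c.trials tp μ χ (p.2.get χ)

/-- **Cover logic of `checkB1gJ`.** [folklore] -/
theorem kltpj_coverLogic (c : KLCert) (rows : List KLJRow) (γ : ℚ) (hc : checkB1gJ c rows γ = true) :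
    (c.mub < c.mua ∧ 0 < γ) ∧ rows.length = c.boxes.length ∧
    (∀ p ∈ c.boxes.zip rows, jointBoxOK p.1 c.trials p.2 γ = true) ∧
    (∀ μ : ℝ, ((c.mub : ℚ) : ℝ) ≤ μ → μ ≤ ((c.mua : ℚ) : ℝ) →
      ∃ bx ∈ c.boxes, ((bx.mulo : ℚ) : ℝ) ≤ μ ∧ μ ≤ ((bx.muhi : ℚ) : ℝ)) := by
  unfold checkB1gJ at hc
  simp only [Bool.and_eq_true, decide_eq_true_eq] at hc
  obtain ⟨⟨⟨⟨⟨h₁, h₂⟩, hmatch⟩, hchain⟩, hlen⟩, hall⟩ := hc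
  refine ⟨⟨h₁, h₂⟩, hlen, ?_, ?_⟩
  · intro p hp
    exact List.all_eq_true.1 hall p hp
  · intro μ hμ₁ hμ₂
    split at hmatch
    · rename_i b₀ b₁ hb₀ hb₁
      simp only [Bool.and_eq_true, decide_eq_true_eq] at hmatch
      obtain ⟨L, hL⟩ := List.head?_eq_some_iff.1 hb₀
      rw [hL] at hchain hb₁ ⊢
      have hlo : ((b₀.mulo : ℚ) : ℝ) ≤ μ := le_trans (by exact_mod_cast hmatch.1) hμ₁
      have hhi : μ ≤ ((b₁.muhi : ℚ) : ℝ) := le_trans hμ₂ (by exact_mod_cast hmatch.2)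
      exact kl_cvl_chain_cover L b₀ b₁ hchain hb₁ μ hlo hhi
    · exact absurd hmatch Bool.false_ne_true

/-- **One box of a joint record at hopping `t′`**: the joint literals of the box, the analytic facts at `μ`, the `B1g` Ritz enclosures
and the four joint enclosures give `channelInf ε_{t′} μ 1 B1g + γ ≤ channelInf ε_{t′} μ 1 χ` for every `χ ≠ B1g`. [folklore] -/
theorem kltpj_box_certificate {tp μ : ℝ} (hA : KLTPAnalytic (squareDispersion 1 tp) μ) (bx : KLBox) (tab : List KLTrig)
    (row : KLJRow) (γ : ℚ) (hJ : jointBoxOK bx tab row γ = true) (hER : bx.bB1g.RitzEnclosureTP tab tp μ)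
    (hE : ∀ χ : D4Irrep, χ ≠ D4Irrep.B1g → JointEnclosureTP bx.bB1g (bx.blk χ) tab tp μ χ (row.get χ)) :
    ∀ χ : D4Irrep, χ ≠ D4Irrep.B1g →
      channelInf (squareDispersion 1 tp) μ 1 D4Irrep.B1g + ((γ : ℚ) : ℝ) ≤ channelInf (squareDispersion 1 tp) μ 1 χ := by
  have hJ' := hJ
  simp only [jointBoxOK, Bool.and_eq_true] at hJ'
  obtain ⟨⟨⟨⟨hR, hA1⟩, hA2⟩, hB2⟩, hEE⟩ := hJ'
  have key : ∀ (χ : D4Irrep) (b : KLBlock), χ ≠ D4Irrep.B1g → bx.blk χ = b →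
      jointBlockOK b tab χ (row.get χ) γ = true →
      channelInf (squareDispersion 1 tp) μ 1 D4Irrep.B1g + ((γ : ℚ) : ℝ) ≤ channelInf (squareDispersion 1 tp) μ 1 χ := by
    intro χ b hχ hb hok
    have hok' := hok
    unfold jointBlockOK at hok'
    rw [Bool.and_eq_true, Bool.and_eq_true] at hok'
    obtain ⟨⟨hdefl, hwu⟩, hγ⟩ := hok'
    exact joint_box_certificate' hA bx.bB1g b tab χ γ (row.get χ) hR (of_decide_eq_true hγ) hER hdefl hwu (hb ▸ hE χ hχ)
  intro χ hχ
  cases χ with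
  | A1g => exact key .A1g bx.bA1g (by decide) rfl hA1
  | A2g => exact key .A2g bx.bA2g (by decide) rfl hA2
  | B1g => exact absurd rfl hχ
  | B2g => exact key .B2g bx.bB2g (by decide) rfl hB2
  | E => exact key .E bx.bE (by decide) rfl hEE

/-- **The t′ WINDOW statement from a JOINT record, hypothesis style**: an accepted joint record (`checkB1gJ c rows γ`), the analytic
facts at `(squareDispersion 1 tp, μ)` for every `μ` of every box, and the joint enclosures `JointEnclosuresB1gTP c rows tp` give
`KLB1gDominatesAtTP tp mub mua γ` — literally the conclusion shape of `kltp_window`. [cite: RaghuKivelsonScalapino2010, §III Fig. 2 and Fig. 3] -/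
theorem kltpj_window (tp : ℝ) (c : KLCert) (rows : List KLJRow) (γ : ℚ) (hc : checkB1gJ c rows γ = true)
    (hA : ∀ bx ∈ c.boxes, ∀ μ ∈ Set.Icc (bx.mulo : ℝ) (bx.muhi : ℝ), KLTPAnalytic (squareDispersion 1 tp) μ)
    (hE : JointEnclosuresB1gTP c rows tp) :
    KLB1gDominatesAtTP tp ((c.mub : ℚ) : ℝ) ((c.mua : ℚ) : ℝ) ((γ : ℚ) : ℝ) := by
  obtain ⟨-, hlen, hall, hcover⟩ := kltpj_coverLogic c rows γ hc
  intro μ hμ χ hχ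
  obtain ⟨bx, hbx, hlo, hhi⟩ := hcover μ hμ.1 hμ.2
  obtain ⟨i, hi, hbxi⟩ := List.mem_iff_getElem.1 hbx
  subst hbxi
  have hiz : i < (c.boxes.zip rows).length := by
    rw [List.length_zip]; omega
  have hmem : (c.boxes.zip rows)[i] ∈ c.boxes.zip rows := List.getElem_mem hiz
  rw [List.getElem_zip] at hmem
  have hJ := hall _ hmem
  obtain ⟨hER, hEχ⟩ := hE _ hmem μ ⟨hlo, hhi⟩
  exact kltpj_box_certificate (hA _ hbx μ ⟨hlo, hhi⟩) _ c.trials _ γ hJ hER hEχ χ hχ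

/-- **The t′ window statement from a JOINT record at every weak coupling**: `KLB1gDominatesTP tp mub mua γ` (`U²`-homogeneity of the
`B1g` bottom and the bare-`U` penalty, from the analytic facts — as in `kltp_window_U`). [cite: RaghuKivelsonScalapino2010, §II (7), (13)] -/
theorem kltpj_window_U (tp : ℝ) (c : KLCert) (rows : List KLJRow) (γ : ℚ) (hc : checkB1gJ c rows γ = true)
    (hA : ∀ bx ∈ c.boxes, ∀ μ ∈ Set.Icc (bx.mulo : ℝ) (bx.muhi : ℝ), KLTPAnalytic (squareDispersion 1 tp) μ)
    (hE : JointEnclosuresB1gTP c rows tp) :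
    KLB1gDominatesTP tp ((c.mub : ℚ) : ℝ) ((c.mua : ℚ) : ℝ) ((γ : ℚ) : ℝ) := by
  obtain ⟨-, -, -, hcover⟩ := kltpj_coverLogic c rows γ hc
  intro μ hμ U hU χ hχ
  obtain ⟨bx, hbx, hlo, hhi⟩ := hcover μ hμ.1 hμ.2
  have hAμ := hA bx hbx μ ⟨hlo, hhi⟩
  have hhom : channelInf (squareDispersion 1 tp) μ U D4Irrep.B1g =
      U ^ 2 * channelInf (squareDispersion 1 tp) μ 1 D4Irrep.B1g :=
    kltp_hs_channelInf_sq hAμ U D4Irrep.B1g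
      (fun ψ hψ => (stub_klMeanZero _ _ hAμ.1 hAμ.2.1 D4Irrep.B1g ψ (by decide) hψ).2)
  have hpen : U ^ 2 * channelInf (squareDispersion 1 tp) μ 1 χ ≤ channelInf (squareDispersion 1 tp) μ U χ :=
    kltp_hs_sq_channelInf_one_le hAμ hU.1 hU.2.le χ
  have h1 := mul_le_mul_of_nonneg_left (kltpj_window tp c rows γ hc hA hE μ hμ χ hχ) (sq_nonneg U)
  rw [hhom]
  nlinarith

end Summit.HubbardSuperconductivity.HubbardSuperconductivity.Theorems.KlCertTPrimeJoint

end
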